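import Mathlib
import Literature.Analysis.SpecialFunctions.GaussLegendreQuadrature

/-!
# Gauss–Legendre quadrature: the error term

For `f ∈ C^{2n}` and the `n`-point Gauss–Legendre rule (nodes = zeros of `P_n`, weights = the
Christoffel numbers `λ_x`, file `GaussLegendreQuadrature.lean`),

  `∫_{-1}^{1} f - Σ_x λ_x f(x) = 2^{2n+1} (n!)^4 / ((2n+1) ((2n)!)^3) · f^{(2n)}(ξ)`,
  `-1 < ξ < 1`

[cite: DavisRabinowitz1984, (2.7.11)] [cite: StoerBulirsch2002, Thm. 3.6.24], together with the
two-sided bound it is used as in validated quadrature (`m ≤ f^{(2n)} ≤ M` on `[-1, 1]`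
brackets the error between `m γ_n` and `M γ_n`).  The proof is the textbook one
[cite: StoerBulirsch2002, Thm. 3.6.24]: Hermite interpolation of `f` at the nodes (existence =
[cite: StoerBulirsch2002, Thm. 2.1.5.2], remainder = [cite: StoerBulirsch2002, Thm. 2.1.5.10], both
in the special case of double nodes at the zeros of `P_n`, by repeated Rolle), exactness of
the rule in degree `≤ 2n-1` (`integral_eq_sum_gaussLegendreWeight_mul`), `∫ P_n² = 2/(2n+1)`
(`integral_legendre_sq`) and the leading coefficient `p_n = (2n)!/(2ⁿ(n!)²)`
(`leadingCoeff_legendre`); the intermediate point `ξ` is placed in the OPEN interval by the strict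
monotonicity of the integral.

Hypothesis on `f`: `ContDiff ℝ (2 * n) f` (globally `C^{2n}`;
`f^{(2n)}` = `iteratedDeriv (2 * n) f`).
The last section transports everything to a general interval `[a, b]`
[cite: DavisRabinowitz1984, (2.7.12)].

## References

* P. J. Davis, P. Rabinowitz, *Methods of Numerical Integration*, 2nd ed. (1984), §2.7,
  (2.7.11)–(2.7.12). [cite: DavisRabinowitz1984, (2.7.11)]
* J. Stoer, R. Bulirsch, *Introduction to Numerical Analysis*, 3rd ed. (2002), Thm. 3.6.24,
  Thm. 2.1.5.2, Thm. 2.1.5.10. [cite: StoerBulirsch2002, Thm. 3.6.24]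

AI-produced formalisation (H21 engines group, seat eng-cap-1, 2026-08-20); no facts, no axioms
beyond Mathlib's, no `sorry`.
-/

open Polynomial Set

open scoped Nat

namespace Literature.Analysis.SpecialFunctions

/-! ### Rolle's theorem on finite zero sets -/

/-- Rolle between consecutive zeros: if the continuous `g` vanishes on a nonempty finite set `s`,
then `deriv g` vanishes on a finite set `s'` with `#s' + 1 = #s`, each point of `s'` lying strictly
between two points of `s` and outside `s`. [folklore] -/
private theorem rolle_finset {g : ℝ → ℝ} (hg : Continuous g) (s : Finset ℝ) :
    s.Nonempty → (∀ x ∈ s, g x = 0) →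
      ∃ s' : Finset ℝ, s'.card + 1 = s.card ∧ (∀ x ∈ s', deriv g x = 0) ∧
        ∀ x ∈ s', x ∉ s ∧ (∃ a ∈ s, a < x) ∧ (∃ b ∈ s, x < b) := by
  classical
  induction s using Finset.induction_on_min with
  | empty => intro hne; exact absurd hne Finset.not_nonempty_empty
  | insert a t hlt ih =>
    intro _ hzero
    have hat : a ∉ t := fun h => lt_irrefl a (hlt a h)
    rcases t.eq_empty_or_nonempty with rfl | ht
    · exact ⟨∅, by simp, by simp, by simp⟩
    set b := t.min' ht with hb
    have hbt : b ∈ t := Finset.min'_mem t ht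
    have hab : a < b := hlt b hbt
    have hga : g a = 0 := hzero a (Finset.mem_insert_self a t)
    have hgb : g b = 0 := hzero b (Finset.mem_insert_of_mem hbt)
    obtain ⟨c, hc, hc0⟩ :=
      exists_deriv_eq_zero (f := g) hab hg.continuousOn (by rw [hga, hgb])
    obtain ⟨t', ht'card, ht'zero, ht'loc⟩ :=
      ih ht (fun x hx => hzero x (Finset.mem_insert_of_mem hx))
    have hct' : c ∉ t' := by
      intro h
      obtain ⟨-, ⟨a', ha't, ha'c⟩, -⟩ := ht'loc c h
      have : b ≤ a' := Finset.min'_le t a' ha't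
      linarith [hc.2]
    refine ⟨insert c t', ?_, ?_, ?_⟩
    · rw [Finset.card_insert_of_notMem hct', Finset.card_insert_of_notMem hat, ht'card]
    · intro x hx
      rcases Finset.mem_insert.mp hx with rfl | hx
      · exact hc0
      · exact ht'zero x hx
    · intro x hx
      rcases Finset.mem_insert.mp hx with rfl | hx
      · refine ⟨?_, ⟨a, Finset.mem_insert_self a t, hc.1⟩,
          ⟨b, Finset.mem_insert_of_mem hbt, hc.2⟩⟩
        intro hmem
        rcases Finset.mem_insert.mp hmem with h | h
        · exact lt_irrefl a (h ▸ hc.1)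
        · have : b ≤ x := Finset.min'_le t x h
          linarith [hc.2]
      · obtain ⟨hxt, ⟨a', ha't, ha'x⟩, ⟨b', hb't, hxb'⟩⟩ := ht'loc x hx
        refine ⟨?_, ⟨a', Finset.mem_insert_of_mem ha't, ha'x⟩,
          ⟨b', Finset.mem_insert_of_mem hb't, hxb'⟩⟩
        intro hmem
        rcases Finset.mem_insert.mp hmem with h | h
        · have := hlt a' ha't
          rw [h] at ha'x
          linarith
        · exact hxt h

/-- Iterated Rolle: if `F ∈ C^N`, `k + m ≤ N`, and `F^{(k)}` vanishes at `m + 1` points of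
`(-1, 1)`, then `F^{(k+m)}` vanishes somewhere in `(-1, 1)`. [folklore] -/
private theorem rolle_chain {F : ℝ → ℝ} {N : ℕ} (hF : ContDiff ℝ N F) :
    ∀ (m k : ℕ) (S : Finset ℝ), k + m ≤ N → S.card = m + 1 →
      (∀ x ∈ S, x ∈ Ioo (-1 : ℝ) 1) → (∀ x ∈ S, iteratedDeriv k F x = 0) →
        ∃ ξ ∈ Ioo (-1 : ℝ) 1, iteratedDeriv (k + m) F ξ = 0 := by
  intro m
  induction m with
  | zero =>
    intro k S _ hcard hS hzero
    obtain ⟨x, hx⟩ := Finset.card_pos.mp (by omega : 0 < S.card)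
    exact ⟨x, hS x hx, by simpa using hzero x hx⟩
  | succ m ih =>
    intro k S hkm hcard hS hzero
    have hcont : Continuous (iteratedDeriv k F) :=
      hF.continuous_iteratedDeriv k (by exact_mod_cast (by omega : k ≤ N))
    obtain ⟨S', hS'card, hS'zero, hS'loc⟩ :=
      rolle_finset hcont S (Finset.card_pos.mp (by omega)) hzero
    obtain ⟨ξ, hξ, h⟩ := ih (k + 1) S' (by omega) (by omega)
      (fun x hx => by
        obtain ⟨-, ⟨a, ha, hax⟩, ⟨b, hb, hxb⟩⟩ := hS'loc x hx
        exact ⟨(hS a ha).1.trans hax, hxb.trans (hS b hb).2⟩)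
      (fun x hx => by rw [iteratedDeriv_succ]; exact hS'zero x hx)
    exact ⟨ξ, hξ, by rw [show k + (m + 1) = k + 1 + m by ring]; exact h⟩

/-! ### Polynomials as smooth functions -/

/-- Polynomial functions are `C^k`. [folklore] -/
private theorem contDiff_eval_poly (p : ℝ[X]) (k : ℕ) : ContDiff ℝ k fun x => p.eval x := by
  induction p using Polynomial.induction_on' with
  | add p q hp hq =>
    simp only [eval_add]
    exact hp.add hq
  | monomial m a =>
    simp only [eval_monomial]
    exact contDiff_const.mul (contDiff_id.pow m)

/-- The `k`-th derivative of `x ↦ p(x)` is `x ↦ p^{(k)}(x)`. [folklore] -/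
private theorem iteratedDeriv_eval_poly (p : ℝ[X]) (k : ℕ) :
    iteratedDeriv k (fun x => p.eval x) = fun x => (derivative^[k] p).eval x := by
  induction k generalizing p with
  | zero => simp
  | succ k ih =>
    rw [iteratedDeriv_succ', Function.iterate_succ_apply]
    have : deriv (fun x => p.eval x) = fun x => p.derivative.eval x :=
      funext fun x => Polynomial.deriv p
    rw [this, ih]

/-! ### Hermite interpolation at the Gauss–Legendre nodes -/

/-- **Existence of the Hermite interpolant** with double nodes: for every finite `s ⊆ ℝ` and
data `y, y'` there is a polynomial of degree `< 2·#s` taking the values `y` and derivative values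
`y'` on `s` (injectivity of `h ↦ (h(xᵢ), h'(xᵢ))ᵢ` on `ℝ[X]_{<2#s}` by counting roots with
multiplicity, then dimension count). [cite: StoerBulirsch2002, Thm. 2.1.5.2] -/
theorem exists_hermite_interpolant (s : Finset ℝ) (y y' : ℝ → ℝ) :
    ∃ h : ℝ[X], h.degree < (2 * s.card : ℕ) ∧
      ∀ x ∈ s, h.eval x = y x ∧ h.derivative.eval x = y' x := by
  classical
  set N := 2 * s.card with hN
  haveI : Module.Finite ℝ (degreeLT ℝ N) := Module.Finite.equiv (degreeLTEquiv ℝ N).symm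
  let L : degreeLT ℝ N →ₗ[ℝ] (s → ℝ) × (s → ℝ) :=
    { toFun := fun p => (fun x => (p : ℝ[X]).eval (x : ℝ),
        fun x => (derivative (p : ℝ[X])).eval (x : ℝ))
      map_add' := fun p q => by ext x <;> simp
      map_smul' := fun c p => by ext x <;> simp }
  have hinj : Function.Injective L := by
    rw [← LinearMap.ker_eq_bot, LinearMap.ker_eq_bot']
    intro p hp
    have hp' : ∀ x ∈ s, (p : ℝ[X]).eval x = 0 ∧ (derivative (p : ℝ[X])).eval x = 0 := by
      intro x hx
      have h1 := congrArg (fun v => v.1 ⟨x, hx⟩) hp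
      have h2 := congrArg (fun v => v.2 ⟨x, hx⟩) hp
      exact ⟨by simpa [L] using h1, by simpa [L] using h2⟩
    by_contra hne
    have hne' : (p : ℝ[X]) ≠ 0 := fun h => hne (Subtype.ext h)
    have hdeg : (p : ℝ[X]).natDegree < N :=
      (natDegree_lt_iff_degree_lt hne').mpr (mem_degreeLT.mp p.2)
    have hle : 2 • s.val ≤ (p : ℝ[X]).roots := by
      refine Multiset.le_iff_count.mpr fun x => ?_
      rw [Multiset.count_nsmul, count_roots]
      by_cases hx : x ∈ s
      · rw [Multiset.count_eq_one_of_mem s.nodup hx, mul_one]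
        exact (one_lt_rootMultiplicity_iff_isRoot hne').mpr ⟨(hp' x hx).1, (hp' x hx).2⟩
      · rw [Multiset.count_eq_zero.mpr (fun h => hx h), mul_zero]
        exact Nat.zero_le _
    have hcard := Multiset.card_le_card hle
    rw [Multiset.card_nsmul, Finset.card_val] at hcard
    have := (p : ℝ[X]).card_roots'
    omega
  have hdim :
      Module.finrank ℝ (degreeLT ℝ N) = Module.finrank ℝ ((s → ℝ) × (s → ℝ)) := by
    rw [(degreeLTEquiv ℝ N).finrank_eq, Module.finrank_fin_fun, Module.finrank_prod,
      Module.finrank_fintype_fun_eq_card, Fintype.card_coe, hN]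
    ring
  have hsurj := (LinearMap.injective_iff_surjective_of_finrank_eq_finrank hdim).mp hinj
  obtain ⟨p, hp⟩ := hsurj (fun x => y x, fun x => y' x)
  refine ⟨p, mem_degreeLT.mp p.2, fun x hx => ?_⟩
  have h1 := congrArg (fun v => v.1 ⟨x, hx⟩) hp
  have h2 := congrArg (fun v => v.2 ⟨x, hx⟩) hp
  exact ⟨by simpa [L] using h1, by simpa [L] using h2⟩

/-- **Hermite interpolation remainder at the Gauss–Legendre nodes.** If `f ∈ C^{2n}` (`n ≥ 1`)
and `h` is a polynomial of degree `< 2n` with `h = f`, `h' = f'` at the `n` zeros of `P_n`, then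
for every `t ∈ [-1, 1]` there is `ξ ∈ (-1, 1)` with
`f(t) - h(t) = f^{(2n)}(ξ) / ((2n)! p_n²) · P_n(t)²` (`p_n` = leading coefficient of `P_n`, so
`P_n(t)²/p_n² = ∏ (t - xᵢ)²`).  Special case (all multiplicities 2) of
[cite: StoerBulirsch2002, Thm. 2.1.5.10]. -/
theorem hermite_remainder_gaussLegendre {n : ℕ} (hn : 0 < n) {f : ℝ → ℝ}
    (hf : ContDiff ℝ (2 * n) f) {h : ℝ[X]} (hdeg : h.degree < (2 * n : ℕ))
    (hval : ∀ x ∈ gaussLegendreNodes n, h.eval x = f x)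
    (hder : ∀ x ∈ gaussLegendreNodes n, h.derivative.eval x = deriv f x)
    {t : ℝ} (ht : t ∈ Icc (-1 : ℝ) 1) :
    ∃ ξ ∈ Ioo (-1 : ℝ) 1, f t - h.eval t =
      iteratedDeriv (2 * n) f ξ / ((2 * n)! * legendreLead n ^ 2) * ((legendre n).eval t) ^ 2 := by
  classical
  set P := legendre n with hP
  by_cases htn : t ∈ gaussLegendreNodes n
  · refine ⟨t, mem_Ioo_of_mem_gaussLegendreNodes htn, ?_⟩
    have hPt : P.eval t = 0 := (mem_gaussLegendreNodes_iff.mp htn)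
    rw [hval t htn, hPt]
    ring
  have hPt : P.eval t ≠ 0 := fun h0 => htn (mem_gaussLegendreNodes_iff.mpr h0)
  -- the auxiliary function `F = f - h - K P²`, `K` chosen so that `F t = 0`
  set K := (f t - h.eval t) / (P.eval t) ^ 2 with hK
  set Q : ℝ[X] := h + C K * (P * P) with hQ
  set F : ℝ → ℝ := fun x => f x - Q.eval x with hF
  have hFcd : ContDiff ℝ (2 * n) F := hf.sub (contDiff_eval_poly Q (2 * n))
  have hFcd' : ContDiff ℝ ((2 * n : ℕ) : WithTop ℕ∞) F := by exact_mod_cast hFcd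
  have hFnode : ∀ x ∈ gaussLegendreNodes n, F x = 0 := by
    intro x hx
    have hPx : P.eval x = 0 := mem_gaussLegendreNodes_iff.mp hx
    simp only [hF, hQ, eval_add, eval_mul, eval_C, hPx, hval x hx]
    ring
  have hFt : F t = 0 := by
    simp only [hF, hQ, eval_add, eval_mul, eval_C, hK]
    field_simp
    ring
  have hF'node : ∀ x ∈ gaussLegendreNodes n, deriv F x = 0 := by
    intro x hx
    have hPx : P.eval x = 0 := mem_gaussLegendreNodes_iff.mp hx
    have h2n : (2 * (n : WithTop ℕ∞)) ≠ 0 := by exact_mod_cast (by omega : 2 * n ≠ 0)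
    have hfd : DifferentiableAt ℝ f x := (hf.differentiable h2n).differentiableAt
    have hQd : DifferentiableAt ℝ (fun x => Q.eval x) x := Q.differentiableAt
    have : deriv F x = deriv f x - deriv (fun x => Q.eval x) x := by
      simp only [hF]
      exact deriv_fun_sub hfd hQd
    rw [this, Polynomial.deriv, hQ]
    simp only [derivative_add, derivative_mul, derivative_C, zero_mul, zero_add, eval_add,
      eval_mul, eval_C, hPx, hder x hx]
    ring
  -- first Rolle step on the `n + 1` zeros `nodes ∪ {t}`
  have hS₀card : (insert t (gaussLegendreNodes n)).card = n + 1 := by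
    rw [Finset.card_insert_of_notMem htn, card_gaussLegendreNodes]
  have hS₀zero : ∀ x ∈ insert t (gaussLegendreNodes n), F x = 0 := by
    intro x hx
    rcases Finset.mem_insert.mp hx with rfl | hx
    · exact hFt
    · exact hFnode x hx
  have hS₀Icc : ∀ x ∈ insert t (gaussLegendreNodes n), x ∈ Icc (-1 : ℝ) 1 := by
    intro x hx
    rcases Finset.mem_insert.mp hx with rfl | hx
    · exact ht
    · exact Ioo_subset_Icc_self (mem_Ioo_of_mem_gaussLegendreNodes hx)
  obtain ⟨S₀', hS₀'card, hS₀'zero, hS₀'loc⟩ :=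
    rolle_finset hFcd.continuous (insert t (gaussLegendreNodes n))
      (Finset.insert_nonempty t _) hS₀zero
  rw [hS₀card] at hS₀'card
  have hdisj : Disjoint S₀' (gaussLegendreNodes n) := by
    rw [Finset.disjoint_left]
    intro x hx hxn
    exact (hS₀'loc x hx).1 (Finset.mem_insert_of_mem hxn)
  have hS₁card : (S₀' ∪ gaussLegendreNodes n).card = (2 * n - 1) + 1 := by
    rw [Finset.card_union_of_disjoint hdisj, card_gaussLegendreNodes]
    omega
  have hS₁Ioo : ∀ x ∈ S₀' ∪ gaussLegendreNodes n, x ∈ Ioo (-1 : ℝ) 1 := by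
    intro x hx
    rcases Finset.mem_union.mp hx with hx | hx
    · obtain ⟨-, ⟨a, ha, hax⟩, ⟨b, hb, hxb⟩⟩ := hS₀'loc x hx
      exact ⟨(hS₀Icc a ha).1.trans_lt hax, hxb.trans_le (hS₀Icc b hb).2⟩
    · exact mem_Ioo_of_mem_gaussLegendreNodes hx
  have hS₁zero : ∀ x ∈ S₀' ∪ gaussLegendreNodes n, iteratedDeriv 1 F x = 0 := by
    intro x hx
    rw [iteratedDeriv_one]
    rcases Finset.mem_union.mp hx with hx | hx
    · exact hS₀'zero x hx
    · exact hF'node x hx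
  -- the remaining `2n - 1` Rolle steps
  obtain ⟨ξ, hξ, hξ0⟩ :=
    rolle_chain hFcd' (2 * n - 1) 1 (S₀' ∪ gaussLegendreNodes n) (by omega) hS₁card hS₁Ioo
      hS₁zero
  rw [show 1 + (2 * n - 1) = 2 * n by omega] at hξ0
  refine ⟨ξ, hξ, ?_⟩
  -- evaluate `F^{(2n)}(ξ) = f^{(2n)}(ξ) - K (2n)! p_n²`
  have hsub : iteratedDeriv (2 * n) F ξ =
      iteratedDeriv (2 * n) f ξ - iteratedDeriv (2 * n) (fun x => Q.eval x) ξ := by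
    simp only [hF]
    exact iteratedDeriv_fun_sub hf.contDiffAt (contDiff_eval_poly Q (2 * n)).contDiffAt
  have hPP : derivative^[2 * n] (P * P) = C (((2 * n)! : ℝ) * legendreLead n ^ 2) := by
    have hnat : (P * P).natDegree ≤ 2 * n := by
      refine (natDegree_mul_le).trans ?_
      rw [hP, natDegree_legendre]; omega
    rw [iterate_derivative_eq_C_of_natDegree_le hnat]
    congr 1
    have : (P * P).coeff (2 * n) = legendreLead n ^ 2 := by
      have h2 : 2 * n = P.natDegree + P.natDegree := by rw [hP, natDegree_legendre]; ring
      rw [h2, coeff_mul_degree_add_degree, hP, leadingCoeff_legendre]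
      ring
    rw [this]
  have hQ2n : iteratedDeriv (2 * n) (fun x => Q.eval x) ξ =
      K * ((2 * n)! * legendreLead n ^ 2) := by
    rw [iteratedDeriv_eval_poly]
    show (derivative^[2 * n] Q).eval ξ = _
    have hadd : derivative^[2 * n] (h + C K * (P * P)) =
        derivative^[2 * n] h + derivative^[2 * n] (C K * (P * P)) :=
      iterate_map_add derivative (2 * n) h _
    rw [hQ, hadd, iterate_derivative_eq_zero_of_degree_lt hdeg, iterate_derivative_C_mul, hPP,
      zero_add, eval_mul, eval_C, eval_C]
  have hKeq : K = iteratedDeriv (2 * n) f ξ / ((2 * n)! * legendreLead n ^ 2) := by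
    have hD : ((2 * n)! : ℝ) * legendreLead n ^ 2 ≠ 0 :=
      mul_ne_zero (by exact_mod_cast (Nat.factorial_ne_zero _))
        (pow_ne_zero _ (legendreLead_pos n).ne')
    rw [eq_div_iff hD]
    have := hξ0
    rw [hsub, hQ2n] at this
    linarith
  have hrem : f t - h.eval t = K * (P.eval t) ^ 2 := by
    rw [hK, div_mul_cancel₀ _ (pow_ne_zero 2 hPt)]
  rw [hrem, hKeq]

/-! ### The error term -/

/-- The error constant `γ_n = 2^{2n+1} (n!)^4 / ((2n+1) ((2n)!)^3)` of the `n`-point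
Gauss–Legendre rule on `[-1, 1]` (`γ_1 = 1/3`, `γ_2 = 1/135`).
[cite: DavisRabinowitz1984, (2.7.11)] -/
noncomputable def gaussLegendreErrorConst (n : ℕ) : ℝ :=
  2 ^ (2 * n + 1) * (n ! : ℝ) ^ 4 / ((2 * n + 1) * ((2 * n)! : ℝ) ^ 3)

/-- `γ_n > 0` (the constant of (2.7.11) is positive).
[cite: DavisRabinowitz1984, (2.7.11)] -/
theorem gaussLegendreErrorConst_pos (n : ℕ) : 0 < gaussLegendreErrorConst n := by
  unfold gaussLegendreErrorConst; positivity

/-- `γ_n = 1 / ((2n)! k_n²)` with `k_n² = p_n² (2n+1)/2` the squared leading coefficient of the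
orthonormal Legendre polynomial, i.e. `γ_n = (2/(2n+1)) / ((2n)! p_n²)`: the specialisation
`w ≡ 1` of the general Gauss error constant. [cite: DavisRabinowitz1984, (2.7.9)] -/
theorem gaussLegendreErrorConst_eq (n : ℕ) :
    gaussLegendreErrorConst n = 2 / (2 * n + 1) / ((2 * n)! * legendreLead n ^ 2) := by
  unfold gaussLegendreErrorConst legendreLead
  have h1 : ((2 * n)! : ℝ) ≠ 0 := by exact_mod_cast Nat.factorial_ne_zero _
  have h2 : ((n)! : ℝ) ≠ 0 := by exact_mod_cast Nat.factorial_ne_zero _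
  have h3 : (2 : ℝ) ^ n ≠ 0 := pow_ne_zero _ two_ne_zero
  have h4 : (2 * (n : ℝ) + 1) ≠ 0 := by positivity
  field_simp
  ring

/-- Common core of the two error theorems: a Hermite interpolant `h` of `f` at the nodes, the
reduction `E_n(f) = ∫ (f - h)`, and the pointwise representation of `f - h`. [folklore] -/
private theorem error_core {n : ℕ} (hn : 0 < n) {f : ℝ → ℝ} (hf : ContDiff ℝ (2 * n) f) :
    ∃ h : ℝ[X],
      ((∫ t in (-1 : ℝ)..1, f t) - ∑ x ∈ gaussLegendreNodes n, gaussLegendreWeight n x * f x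
          = ∫ t in (-1 : ℝ)..1, (f t - h.eval t)) ∧
      Continuous (fun t => f t - h.eval t) ∧
      ∀ t ∈ Icc (-1 : ℝ) 1, ∃ ξ ∈ Ioo (-1 : ℝ) 1, f t - h.eval t =
        iteratedDeriv (2 * n) f ξ *
          (((legendre n).eval t) ^ 2 / ((2 * n)! * legendreLead n ^ 2)) := by
  classical
  obtain ⟨h, hdeg, hh⟩ :=
    exists_hermite_interpolant (gaussLegendreNodes n) f (deriv f)
  rw [card_gaussLegendreNodes] at hdeg
  have hval : ∀ x ∈ gaussLegendreNodes n, h.eval x = f x := fun x hx => (hh x hx).1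
  have hder : ∀ x ∈ gaussLegendreNodes n, h.derivative.eval x = deriv f x :=
    fun x hx => (hh x hx).2
  have hnat : h.natDegree < 2 * n := by
    by_cases h0 : h = 0
    · rw [h0, natDegree_zero]; omega
    · exact (natDegree_lt_iff_degree_lt h0).mpr hdeg
  have hfc : Continuous f := hf.continuous
  have hhc : Continuous fun t => h.eval t := h.continuous
  refine ⟨h, ?_, hfc.sub hhc, ?_⟩
  · rw [intervalIntegral.integral_sub (hfc.intervalIntegrable _ _) (hhc.intervalIntegrable _ _),
      integral_eq_sum_gaussLegendreWeight_mul hnat]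
    have : ∑ x ∈ gaussLegendreNodes n, gaussLegendreWeight n x * h.eval x =
        ∑ x ∈ gaussLegendreNodes n, gaussLegendreWeight n x * f x :=
      Finset.sum_congr rfl fun x hx => by rw [hval x hx]
    rw [this]
  · intro t ht
    obtain ⟨ξ, hξ, hrem⟩ := hermite_remainder_gaussLegendre hn hf hdeg hval hder ht
    refine ⟨ξ, hξ, ?_⟩
    rw [hrem]
    ring

/-- `∫_{-1}^{1} c · P_n(t)² / ((2n)! p_n²) dt = c · γ_n`. [folklore] -/
private theorem integral_const_mul_sq (n : ℕ) (c : ℝ) :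
    ∫ t in (-1 : ℝ)..1, c * (((legendre n).eval t) ^ 2 / ((2 * n)! * legendreLead n ^ 2)) =
      c * gaussLegendreErrorConst n := by
  rw [intervalIntegral.integral_const_mul]
  congr 1
  simp_rw [div_eq_mul_inv]
  rw [intervalIntegral.integral_mul_const, integral_legendre_sq, gaussLegendreErrorConst_eq]
  ring

/-- **Two-sided error bound for Gauss–Legendre quadrature.** If `f ∈ C^{2n}` (`n ≥ 1`) and
`m ≤ f^{(2n)} ≤ M` on `[-1, 1]`, then
`m γ_n ≤ ∫_{-1}^{1} f - Σ_x λ_x f(x) ≤ M γ_n`, `γ_n = 2^{2n+1}(n!)^4/((2n+1)((2n)!)^3)`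
(the form in which (2.7.11) is used for validated bounds). [cite: DavisRabinowitz1984, (2.7.11)]
[cite: StoerBulirsch2002, Thm. 3.6.24] -/
theorem gaussLegendre_error_mem_Icc {n : ℕ} (hn : 0 < n) {f : ℝ → ℝ} (hf : ContDiff ℝ (2 * n) f)
    {m M : ℝ} (hm : ∀ x ∈ Icc (-1 : ℝ) 1, m ≤ iteratedDeriv (2 * n) f x)
    (hM : ∀ x ∈ Icc (-1 : ℝ) 1, iteratedDeriv (2 * n) f x ≤ M) :
    (∫ t in (-1 : ℝ)..1, f t) - ∑ x ∈ gaussLegendreNodes n, gaussLegendreWeight n x * f x ∈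
      Icc (m * gaussLegendreErrorConst n) (M * gaussLegendreErrorConst n) := by
  obtain ⟨h, hE, hcont, hrep⟩ := error_core hn hf
  set w : ℝ → ℝ := fun t => ((legendre n).eval t) ^ 2 / ((2 * n)! * legendreLead n ^ 2) with hw
  have hwc : Continuous w := by
    simp only [hw]
    exact ((legendre n).continuous.pow 2).div_const _
  have hw0 : ∀ t, 0 ≤ w t := fun t =>
    div_nonneg (sq_nonneg _) (mul_nonneg (Nat.cast_nonneg _) (sq_nonneg _))
  have hle : (-1 : ℝ) ≤ 1 := by norm_num
  rw [hE]
  constructor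
  · rw [← integral_const_mul_sq n m]
    refine intervalIntegral.integral_mono_on hle ((continuous_const.mul hwc).intervalIntegrable _ _)
      (hcont.intervalIntegrable _ _) fun t ht => ?_
    obtain ⟨ξ, hξ, hr⟩ := hrep t ht
    rw [hr]
    exact mul_le_mul_of_nonneg_right (hm ξ (Ioo_subset_Icc_self hξ)) (hw0 t)
  · rw [← integral_const_mul_sq n M]
    refine intervalIntegral.integral_mono_on hle (hcont.intervalIntegrable _ _)
      ((continuous_const.mul hwc).intervalIntegrable _ _) fun t ht => ?_
    obtain ⟨ξ, hξ, hr⟩ := hrep t ht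
    rw [hr]
    exact mul_le_mul_of_nonneg_right (hM ξ (Ioo_subset_Icc_self hξ)) (hw0 t)

/-- Corollary: `|∫_{-1}^{1} f - Σ_x λ_x f(x)| ≤ γ_n · sup_{[-1,1]} |f^{(2n)}|`.
[cite: DavisRabinowitz1984, (2.7.11)] -/
theorem abs_gaussLegendre_error_le {n : ℕ} (hn : 0 < n) {f : ℝ → ℝ} (hf : ContDiff ℝ (2 * n) f)
    {M : ℝ} (hM : ∀ x ∈ Icc (-1 : ℝ) 1, |iteratedDeriv (2 * n) f x| ≤ M) :
    |(∫ t in (-1 : ℝ)..1, f t) - ∑ x ∈ gaussLegendreNodes n, gaussLegendreWeight n x * f x| ≤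
      gaussLegendreErrorConst n * M := by
  have h := gaussLegendre_error_mem_Icc hn hf (m := -M) (M := M)
    (fun x hx => (abs_le.mp (hM x hx)).1) (fun x hx => (abs_le.mp (hM x hx)).2)
  rw [abs_le]
  constructor <;> nlinarith [h.1, h.2, gaussLegendreErrorConst_pos n]

/-- **The Gauss–Legendre error term** (Davis–Rabinowitz (2.7.11); Stoer–Bulirsch Thm. 3.6.24 with
`ω ≡ 1`, `[a, b] = [-1, 1]`): if `f ∈ C^{2n}` and `n ≥ 1`, then for some `ξ ∈ (-1, 1)`,
`∫_{-1}^{1} f - Σ_x λ_x f(x) = 2^{2n+1} (n!)^4 / ((2n+1) ((2n)!)^3) · f^{(2n)}(ξ)`.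
[cite: DavisRabinowitz1984, (2.7.11)] [cite: StoerBulirsch2002, Thm. 3.6.24] -/
theorem gaussLegendre_error_eq {n : ℕ} (hn : 0 < n) {f : ℝ → ℝ} (hf : ContDiff ℝ (2 * n) f) :
    ∃ ξ ∈ Ioo (-1 : ℝ) 1,
      (∫ t in (-1 : ℝ)..1, f t) - ∑ x ∈ gaussLegendreNodes n, gaussLegendreWeight n x * f x =
        gaussLegendreErrorConst n * iteratedDeriv (2 * n) f ξ := by
  classical
  obtain ⟨h, hE, hcont, hrep⟩ := error_core hn hf
  set q := iteratedDeriv (2 * n) f with hq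
  set γ := gaussLegendreErrorConst n with hγ
  set E := (∫ t in (-1 : ℝ)..1, f t) - ∑ x ∈ gaussLegendreNodes n, gaussLegendreWeight n x * f x
    with hEdef
  set w : ℝ → ℝ := fun t => ((legendre n).eval t) ^ 2 / ((2 * n)! * legendreLead n ^ 2) with hw
  have hγ0 : 0 < γ := gaussLegendreErrorConst_pos n
  have hqc : Continuous q := hf.continuous_iteratedDeriv (2 * n) le_rfl
  have hwc : Continuous w := by
    simp only [hw]
    exact ((legendre n).continuous.pow 2).div_const _
  have hD0 : (0 : ℝ) < (2 * n)! * legendreLead n ^ 2 :=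
    mul_pos (by exact_mod_cast Nat.factorial_pos _) (pow_pos (legendreLead_pos n) 2)
  have hw0 : ∀ t, 0 ≤ w t := fun t => div_nonneg (sq_nonneg _) hD0.le
  have hle : (-1 : ℝ) ≤ 1 := by norm_num
  have hlt : (-1 : ℝ) < 1 := by norm_num
  -- extrema of `q` on `[-1, 1]`
  have hne : (Icc (-1 : ℝ) 1).Nonempty := nonempty_Icc.mpr hle
  obtain ⟨xm, hxm, hmin⟩ := isCompact_Icc.exists_isMinOn hne hqc.continuousOn
  obtain ⟨xM, hxM, hmax⟩ := isCompact_Icc.exists_isMaxOn hne hqc.continuousOn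
  have hbounds := gaussLegendre_error_mem_Icc hn hf (m := q xm) (M := q xM)
    (fun x hx => hmin hx) (fun x hx => hmax hx)
  rw [← hEdef] at hbounds
  -- a non-node point of `(-1, 1)` where the pointwise representation is strict information
  obtain ⟨t₀, ht₀, ht₀n⟩ :=
    (Ioo_infinite hlt).exists_notMem_finset (gaussLegendreNodes n)
  have hwt₀ : 0 < w t₀ := by
    have hPt : (legendre n).eval t₀ ≠ 0 := fun h0 => ht₀n (mem_gaussLegendreNodes_iff.mpr h0)
    exact div_pos (by positivity) hD0
  obtain ⟨ξ₀, hξ₀, hr₀⟩ := hrep t₀ (Ioo_subset_Icc_self ht₀)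
  -- `E = ∫ (f - h)`, and the comparison integrals
  have hIq : ∀ c : ℝ, ∫ t in (-1 : ℝ)..1, c * w t = c * γ := fun c => integral_const_mul_sq n c
  -- strictness: if `q ξ₀ ≠ c` for an extremal value `c` attained by `E/γ`, contradiction
  have hstrict_lo : E = q xm * γ → q ξ₀ = q xm := by
    intro hEq
    by_contra hneq
    have hgt : q xm < q ξ₀ := lt_of_le_of_ne (hmin (Ioo_subset_Icc_self hξ₀)) (Ne.symm hneq)
    have hlt' : (∫ t in (-1 : ℝ)..1, q xm * w t) < ∫ t in (-1 : ℝ)..1, (f t - h.eval t) := by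
      refine intervalIntegral.integral_lt_integral_of_continuousOn_of_le_of_exists_lt hlt
        (continuous_const.mul hwc).continuousOn hcont.continuousOn ?_
        ⟨t₀, Ioo_subset_Icc_self ht₀, ?_⟩
      · intro t ht
        obtain ⟨ξ, hξ, hr⟩ := hrep t (Ioc_subset_Icc_self ht)
        rw [hr]
        exact mul_le_mul_of_nonneg_right (hmin (Ioo_subset_Icc_self hξ)) (hw0 t)
      · rw [hr₀]
        exact mul_lt_mul_of_pos_right hgt hwt₀
    rw [hIq, ← hE, hEq] at hlt'
    exact lt_irrefl _ hlt'
  have hstrict_hi : E = q xM * γ → q ξ₀ = q xM := by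
    intro hEq
    by_contra hneq
    have hgt : q ξ₀ < q xM := lt_of_le_of_ne (hmax (Ioo_subset_Icc_self hξ₀)) hneq
    have hlt' : (∫ t in (-1 : ℝ)..1, (f t - h.eval t)) < ∫ t in (-1 : ℝ)..1, q xM * w t := by
      refine intervalIntegral.integral_lt_integral_of_continuousOn_of_le_of_exists_lt hlt
        hcont.continuousOn (continuous_const.mul hwc).continuousOn ?_
        ⟨t₀, Ioo_subset_Icc_self ht₀, ?_⟩
      · intro t ht
        obtain ⟨ξ, hξ, hr⟩ := hrep t (Ioc_subset_Icc_self ht)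
        rw [hr]
        exact mul_le_mul_of_nonneg_right (hmax (Ioo_subset_Icc_self hξ)) (hw0 t)
      · rw [hr₀]
        exact mul_lt_mul_of_pos_right hgt hwt₀
    rw [hIq, ← hE, hEq] at hlt'
    exact lt_irrefl _ hlt'
  -- case analysis on where `E/γ` sits in `[q xm, q xM]`
  by_cases hlo : E ≤ q xm * γ
  · have hEq : E = q xm * γ := le_antisymm hlo hbounds.1
    exact ⟨ξ₀, hξ₀, by rw [hEq, hstrict_lo hEq, mul_comm]⟩
  by_cases hhi : q xM * γ ≤ E
  · have hEq : E = q xM * γ := le_antisymm hbounds.2 hhi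
    exact ⟨ξ₀, hξ₀, by rw [hEq, hstrict_hi hEq, mul_comm]⟩
  push Not at hlo hhi
  -- strict intermediate value between `xm` and `xM`
  have hc : E / γ ∈ Ioo (q xm) (q xM) := by
    constructor
    · rwa [lt_div_iff₀ hγ0]
    · rwa [div_lt_iff₀ hγ0]
  rcases le_total xm xM with hmM | hMm
  · have hIcc : Icc xm xM ⊆ Icc (-1 : ℝ) 1 := Icc_subset_Icc hxm.1 hxM.2
    obtain ⟨ξ, hξ, hqξ⟩ := intermediate_value_Ioo hmM (hqc.continuousOn.mono hIcc) hc
    refine ⟨ξ, ⟨hxm.1.trans_lt hξ.1, hξ.2.trans_le hxM.2⟩, ?_⟩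
    rw [hqξ, mul_div_cancel₀ _ hγ0.ne']
  · have hIcc : Icc xM xm ⊆ Icc (-1 : ℝ) 1 := Icc_subset_Icc hxM.1 hxm.2
    obtain ⟨ξ, hξ, hqξ⟩ := intermediate_value_Ioo' hMm (hqc.continuousOn.mono hIcc) hc
    refine ⟨ξ, ⟨hxM.1.trans_lt hξ.1, hξ.2.trans_le hxm.2⟩, ?_⟩
    rw [hqξ, mul_div_cancel₀ _ hγ0.ne']

/-! ### The rule on a general interval `[a, b]`

Transport by the affine map `x ↦ (b-a)/2 · x + (a+b)/2`: nodes `(b-a)/2 · xᵢ + (a+b)/2`, weights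
`(b-a)/2 · λᵢ`, and the error term
`∫_a^b f - Σᵢ (b-a)/2 λᵢ f((b-a)/2 xᵢ + (a+b)/2)`
`= (b-a)^{2n+1} (n!)^4 / ((2n+1) ((2n)!)^3) f^{(2n)}(ξ)`, `a < ξ < b`.
[cite: DavisRabinowitz1984, (2.7.12)] -/

/-- The affine change of variables in the constant:
`γ_n · ((b-a)/2)^{2n+1} = (b-a)^{2n+1} (n!)^4 / ((2n+1) ((2n)!)^3)`. [folklore] -/
private theorem errorConst_mul_pow (n : ℕ) (a b : ℝ) :
    ((b - a) / 2) ^ (2 * n + 1) * gaussLegendreErrorConst n =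
      (b - a) ^ (2 * n + 1) * (n ! : ℝ) ^ 4 / ((2 * n + 1) * ((2 * n)! : ℝ) ^ 3) := by
  unfold gaussLegendreErrorConst
  have h2 : (2 : ℝ) ^ (2 * n + 1) ≠ 0 := pow_ne_zero _ two_ne_zero
  rw [div_pow]
  field_simp

/-- Transport lemma: for `g x = f ((b-a)/2 · x + (a+b)/2)`,
`∫_a^b f = (b-a)/2 · ∫_{-1}^{1} g` and `g^{(k)}(x) = ((b-a)/2)^k f^{(k)}((b-a)/2 · x + (a+b)/2)`.
[folklore] -/
private theorem transport {k : ℕ} {f : ℝ → ℝ} (hf : ContDiff ℝ k f) (a b : ℝ) :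
    ((∫ t in a..b, f t) =
        (b - a) / 2 * ∫ x in (-1 : ℝ)..1, f ((b - a) / 2 * x + (a + b) / 2)) ∧
      ContDiff ℝ k (fun x => f ((b - a) / 2 * x + (a + b) / 2)) ∧
      ∀ x, iteratedDeriv k (fun x => f ((b - a) / 2 * x + (a + b) / 2)) x =
        ((b - a) / 2) ^ k * iteratedDeriv k f ((b - a) / 2 * x + (a + b) / 2) := by
  set c := (b - a) / 2 with hc
  set d := (a + b) / 2 with hd
  refine ⟨?_, ?_, ?_⟩
  · have h := intervalIntegral.smul_integral_comp_mul_add f c d (a := -1) (b := 1)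
    rw [smul_eq_mul] at h
    rw [h]
    congr 1 <;> simp only [hc, hd] <;> ring
  · exact hf.comp ((contDiff_const.mul contDiff_id).add contDiff_const)
  · intro x
    have hF : ContDiff ℝ k (fun y => f (y + d)) :=
      hf.comp (contDiff_id.add contDiff_const)
    have h1 : (fun x => f (c * x + d)) = fun x => (fun y => f (y + d)) (c * x) := rfl
    rw [h1, iteratedDeriv_comp_const_mul hF c]
    simp only [iteratedDeriv_comp_add_const]

/-- **Two-sided error bound on `[a, b]`.** If `a < b`, `f ∈ C^{2n}` (`n ≥ 1`) and
`m ≤ f^{(2n)} ≤ M` on `[a, b]`, the error of the transported `n`-point Gauss–Legendre rule lies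
in `[m C, M C]`, `C = (b-a)^{2n+1} (n!)^4 / ((2n+1) ((2n)!)^3)`.
[cite: DavisRabinowitz1984, (2.7.12)] -/
theorem gaussLegendre_error_mem_Icc_interval {n : ℕ} (hn : 0 < n) {a b : ℝ} (hab : a < b)
    {f : ℝ → ℝ} (hf : ContDiff ℝ (2 * n) f) {m M : ℝ}
    (hm : ∀ x ∈ Icc a b, m ≤ iteratedDeriv (2 * n) f x)
    (hM : ∀ x ∈ Icc a b, iteratedDeriv (2 * n) f x ≤ M) :
    (∫ t in a..b, f t) - ∑ x ∈ gaussLegendreNodes n,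
        (b - a) / 2 * gaussLegendreWeight n x * f ((b - a) / 2 * x + (a + b) / 2) ∈
      Icc (m * ((b - a) ^ (2 * n + 1) * (n ! : ℝ) ^ 4 / ((2 * n + 1) * ((2 * n)! : ℝ) ^ 3)))
        (M * ((b - a) ^ (2 * n + 1) * (n ! : ℝ) ^ 4 / ((2 * n + 1) * ((2 * n)! : ℝ) ^ 3))) := by
  have hf' : ContDiff ℝ ((2 * n : ℕ) : WithTop ℕ∞) f := by exact_mod_cast hf
  obtain ⟨hint, hg, hder⟩ := transport hf' a b
  set c := (b - a) / 2 with hc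
  set d := (a + b) / 2 with hd
  set g : ℝ → ℝ := fun x => f (c * x + d) with hgdef
  have hc0 : 0 < c := by rw [hc]; linarith
  have hck : 0 ≤ c ^ (2 * n) := pow_nonneg hc0.le _
  have hmap : ∀ x ∈ Icc (-1 : ℝ) 1, c * x + d ∈ Icc a b := by
    intro x hx
    constructor <;> nlinarith [hx.1, hx.2, hc0]
  have hg' : ContDiff ℝ (2 * n) g := by exact_mod_cast hg
  have hbound := gaussLegendre_error_mem_Icc hn hg' (m := c ^ (2 * n) * m)
    (M := c ^ (2 * n) * M)
    (fun x hx => by rw [hder x]; exact mul_le_mul_of_nonneg_left (hm _ (hmap x hx)) hck)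
    (fun x hx => by rw [hder x]; exact mul_le_mul_of_nonneg_left (hM _ (hmap x hx)) hck)
  have hE : (∫ t in a..b, f t) - ∑ x ∈ gaussLegendreNodes n,
      c * gaussLegendreWeight n x * f (c * x + d) =
      c * ((∫ x in (-1 : ℝ)..1, g x) -
        ∑ x ∈ gaussLegendreNodes n, gaussLegendreWeight n x * g x) := by
    rw [hint, mul_sub, Finset.mul_sum]
    refine congrArg₂ _ rfl (Finset.sum_congr rfl fun x _ => ?_)
    simp only [hgdef]
    ring
  rw [hE, ← errorConst_mul_pow n a b, ← hc]
  constructor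
  · have := mul_le_mul_of_nonneg_left hbound.1 hc0.le
    calc m * (c ^ (2 * n + 1) * gaussLegendreErrorConst n)
        = c * (c ^ (2 * n) * m * gaussLegendreErrorConst n) := by ring
      _ ≤ _ := this
  · have := mul_le_mul_of_nonneg_left hbound.2 hc0.le
    calc c * ((∫ x in (-1 : ℝ)..1, g x) -
          ∑ x ∈ gaussLegendreNodes n, gaussLegendreWeight n x * g x)
        ≤ c * (c ^ (2 * n) * M * gaussLegendreErrorConst n) := this
      _ = M * (c ^ (2 * n + 1) * gaussLegendreErrorConst n) := by ring

/-- **The Gauss–Legendre error term on `[a, b]`**: if `a < b`, `f ∈ C^{2n}` and `n ≥ 1`, then for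
some `ξ ∈ (a, b)`,
`∫_a^b f - Σᵢ (b-a)/2 · λᵢ · f((b-a)/2 · xᵢ + (a+b)/2)`
`= (b-a)^{2n+1} (n!)^4 / ((2n+1) ((2n)!)^3) · f^{(2n)}(ξ)`. [cite: DavisRabinowitz1984, (2.7.12)] -/
theorem gaussLegendre_error_eq_interval {n : ℕ} (hn : 0 < n) {a b : ℝ} (hab : a < b)
    {f : ℝ → ℝ} (hf : ContDiff ℝ (2 * n) f) :
    ∃ ξ ∈ Ioo a b,
      (∫ t in a..b, f t) - ∑ x ∈ gaussLegendreNodes n,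
          (b - a) / 2 * gaussLegendreWeight n x * f ((b - a) / 2 * x + (a + b) / 2) =
        (b - a) ^ (2 * n + 1) * (n ! : ℝ) ^ 4 / ((2 * n + 1) * ((2 * n)! : ℝ) ^ 3) *
          iteratedDeriv (2 * n) f ξ := by
  have hf' : ContDiff ℝ ((2 * n : ℕ) : WithTop ℕ∞) f := by exact_mod_cast hf
  obtain ⟨hint, hg, hder⟩ := transport hf' a b
  set c := (b - a) / 2 with hc
  set d := (a + b) / 2 with hd
  set g : ℝ → ℝ := fun x => f (c * x + d) with hgdef
  have hc0 : 0 < c := by rw [hc]; linarith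
  have hg' : ContDiff ℝ (2 * n) g := by exact_mod_cast hg
  obtain ⟨ξ, hξ, hEq⟩ := gaussLegendre_error_eq hn hg'
  refine ⟨c * ξ + d, ⟨by nlinarith [hξ.1, hξ.2, hc0], by nlinarith [hξ.1, hξ.2, hc0]⟩, ?_⟩
  have hE : (∫ t in a..b, f t) - ∑ x ∈ gaussLegendreNodes n,
      c * gaussLegendreWeight n x * f (c * x + d) =
      c * ((∫ x in (-1 : ℝ)..1, g x) -
        ∑ x ∈ gaussLegendreNodes n, gaussLegendreWeight n x * g x) := by
    rw [hint, mul_sub, Finset.mul_sum]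
    refine congrArg₂ _ rfl (Finset.sum_congr rfl fun x _ => ?_)
    simp only [hgdef]
    ring
  rw [hE, hEq, hder ξ, ← errorConst_mul_pow n a b, ← hc]
  ring

/-- Corollary (the form used by validated integrators): if `|f^{(2n)}| ≤ D` on `[a, b]` then
`|∫_a^b f - Σ_x (b-a)/2·λ_x f((b-a)/2·x + (a+b)/2)| ≤ (b-a)^{2n+1} (n!)^4/((2n+1)((2n)!)^3) · D`.
[cite: DavisRabinowitz1984, (2.7.12)] -/
theorem abs_gaussLegendre_error_le_interval {n : ℕ} (hn : 0 < n) {a b : ℝ} (hab : a < b)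
    {f : ℝ → ℝ} (hf : ContDiff ℝ (2 * n) f) {D : ℝ}
    (hD : ∀ x ∈ Icc a b, |iteratedDeriv (2 * n) f x| ≤ D) :
    |(∫ t in a..b, f t) - ∑ x ∈ gaussLegendreNodes n,
        (b - a) / 2 * gaussLegendreWeight n x * f ((b - a) / 2 * x + (a + b) / 2)| ≤
      (b - a) ^ (2 * n + 1) * (n ! : ℝ) ^ 4 / ((2 * n + 1) * ((2 * n)! : ℝ) ^ 3) * D := by
  have h := gaussLegendre_error_mem_Icc_interval hn hab hf (m := -D) (M := D)
    (fun x hx => (abs_le.mp (hD x hx)).1) (fun x hx => (abs_le.mp (hD x hx)).2)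
  have hC : 0 ≤ (b - a) ^ (2 * n + 1) * (n ! : ℝ) ^ 4 / ((2 * n + 1) * ((2 * n)! : ℝ) ^ 3) := by
    have hba : 0 ≤ b - a := by linarith
    positivity
  rw [abs_le]
  constructor <;> nlinarith [h.1, h.2, hC]

/-- `γ_1 = 1/3` (midpoint rule) and `γ_2 = 1/135` (two-point rule). [folklore] -/
example : gaussLegendreErrorConst 1 = 1 / 3 ∧ gaussLegendreErrorConst 2 = 1 / 135 := by
  unfold gaussLegendreErrorConst
  norm_num [Nat.factorial]

end Literature.Analysis.SpecialFunctions
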